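import Summits.PneNP.PneNP.Theorems.ChebyshevTracialDesignTightEvenRatio
import Summits.PneNP.PneNP.Theorems.ChebyshevTracialDesignTightSecondEigenvalue
import Summits.PneNP.PneNP.Theorems.ChebyshevTracialDesignTightFreeSpectral
import HarnessLib

/-!
# Cell pnp-psdrank, route `ChebyshevTracialDesign`: the even ladder eigenvalues of the tight Gram kernel DECREASE —
# the max-over-κ lemma (referee flag n11) and the σ₂ brick of record

Harmonic backbone of the `r = 1` rung of the crux `TracialDecayExp20` (stmt-PneNP-19878), brick 5h — the number of record of
the σ₂ step (R1-SKELETON S3 / MEMO-6 Rec. 3 «tight-free X × Y ⇒ μν ≲ 1/n»). For the tight incidence `A(U,M) = 1[cc(U,M) = 1]`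
between the `t`-cuts (`t = 2c+1 ≥ 3`, `2t ≤ n`, `n` even) and the perfect matchings of `K_n` [cite: Rothvoss2017, §2 (PDF p. 6):
the rectangles of a nonnegative factorisation avoid the tight pairs] with Gram class function `κ`:
* `kernelEigen_tight_even_nonneg`, `kernelEigen_tight_zero_pos` : `λ_{2κ'} ≥ 0`, `λ₀ > 0` (eng g7's sum-free closed form
  `…TightEvenClosedForm.kernelEigen_tight_even_closed`, p447952);
* `kernelEigen_tight_succ_le` : `λ_{2κ'+2} ≤ λ_{2κ'}` (eng g7's ratio bound `…TightEvenRatio.kernelEigen_tight_even_succ_le`,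
  p449566, times `(2κ'+1)/(n−2κ') ≤ 1`);
* `kernelEigen_tight_even_le_two` : **the max-over-κ lemma (referee flag n11)** `λ_{2κ'} ≤ λ₂` for `1 ≤ κ' ≤ c`, and with the
  vanishing odd layers (`…TightOddLayers`, p443521) `kernelEigen_tight_le_two` : `λ_j ≤ λ₂` for EVERY `1 ≤ j ≤ t` — so Haemers' bound
  runs with `Λ = λ₂` itself and NO tail sum `Σ_{κ'} λ_{2κ'}` is needed (brick 5f's `Λ = Σ λ_{2κ'}` was only a stop-gap);
* `tight_rowSum_eq` : constant row sums of the tight incidence (`rowCount_eq`, p425886);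
and then, by lit's two-sided Haemers bound (`JohnsonSpectrum.card_mul_card_mul_rowSum_mul_colSum_le`, p440013), `λ₀ = d_R·d_C`
(`kernelEigen_zero_eq_rowSum_mul_colSum`) and brick 5g (`λ₂·t(n−t)n = λ₀·(t−1)(n−t−1)`, `kernelEigen_two_mul_eq`, p446018),
**the σ₂ brick of record**
* `tightFree_card_mul_card_le` : for every family `X` of `t`-subsets and every set `Y` of perfect matchings WITHOUT a tight pair,
  `|X| · |Y| · t(n−t)n ≤ (t−1)(n−t−1) · (C(n,t) − |X|) · (|PM_n| − |Y|)`,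
  i.e. `μν ≤ (1−μ)(1−ν)·(t−1)(n−t−1)/(t(n−t)·n) < (1−μ)(1−ν)/n` (sharp constant `1`, not `13`, valid for every `n`, no `o(1)`);
  route vocabulary (`OddSet n`, `cc`): `tightFree_oddSet_card_mul_card_le`; coarse form `|X|·|Y|·n ≤ C(n,t)·|PM_n|`:
  `tightFree_card_mul_card_mul_le`.
[cite: GodsilMeagher2015, §15.2 (perfect matching scheme)] [cite: BrouwerHaemers2012, Thm. 4.9.1 (m' = 0; PDF p. 93)]
Stature: support/instrument (the σ₂ step of the r = 1 rung of an OPEN crux). WHAT THIS IS NOT: not the r = 1 rung, not virtual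
positivity, nothing on psd rank of `P_PM(K_n)`, no P-vs-NP content. Supports crux stmt-PneNP-19878.
-/

set_option linter.dupNamespace false -- `Summit.PneNP.PneNP.…`: summit = sub-problem (D-0017)

noncomputable section

namespace Summit.PneNP.PneNP.Theorems.ChebyshevTracialDesignTightEigenDecay

open Finset Literature.Combinatorics.AssociationSchemes Literature.Combinatorics.AssociationSchemes.JohnsonHarmonics
open Literature.Combinatorics.AssociationSchemes.JohnsonSpectrum
open Literature.Barriers.PneNP
open Summit.PneNP.PneNP.Theorems.ChebyshevTracialDesignClosedPairCount
open Summit.PneNP.PneNP.Theorems.ChebyshevTracialDesignTightEvenClosedForm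
open Summit.PneNP.PneNP.Theorems.ChebyshevTracialDesignTightEvenRatio
open Summit.PneNP.PneNP.Theorems.ChebyshevTracialDesignTightSecondEigenvalue
open Summit.PneNP.PneNP.Theorems.ChebyshevTracialDesignTightOddLayers
open Summit.PneNP.PneNP.Theorems.ChebyshevTracialDesignTightFreeSpectral
open Summit.PneNP.PneNP.Theorems.ChebyshevTracialDesignTightColumnSums
open Summit.PneNP.PneNP.Theorems.ChebyshevTracialDesignLevelMarginals
open Summit.PneNP.PneNP.Theorems.ChebyshevTracialDesignDipoleHitRatio

variable {n : ℕ}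

/-! ### §1 Nonnegativity, positivity of `λ₀`, monotone decay, the max-over-κ lemma -/

/-- The even tight eigenvalues are nonnegative (closed form = square × counts / binomial). -/
theorem kernelEigen_tight_even_nonneg {c κ' : ℕ} (hn : Even n) (ht : 2 * (2 * c + 1) ≤ n) (hκc : κ' ≤ c) (κ : ℕ → ℝ)
    (hA : ∀ U ∈ univ.powersetCard (2 * c + 1), ∀ U' ∈ univ.powersetCard (2 * c + 1),
      ∑ M : PMatch n, (if (U.filter fun x => M.2.partner x ∉ U).card = 1 then (1 : ℝ) else 0) *
        (if (U'.filter fun x => M.2.partner x ∉ U').card = 1 then (1 : ℝ) else 0) = κ (U ∩ U').card) :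
    0 ≤ kernelEigen n (2 * c + 1) (2 * κ') κ := by
  rw [kernelEigen_tight_even_closed hn ht hκc κ hA]
  refine div_nonneg (mul_nonneg (sq_nonneg _) (mul_nonneg (by positivity) (prod_nonneg fun i hi => ?_)))
    (Nat.cast_nonneg _)
  have hi' := mem_range.1 hi
  have h1 : ((i : ℕ) : ℝ) + 1 ≤ κ' := by exact_mod_cast (show i + 1 ≤ κ' by omega)
  have h2 : (4 : ℝ) * κ' ≤ n := by exact_mod_cast (show 4 * κ' ≤ n by omega)
  linarith

/-- **`λ₀ > 0`** for the tight Gram kernel (`n` even, `t = 2c+1`, `2t ≤ n`). -/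
theorem kernelEigen_tight_zero_pos {c : ℕ} (hn : Even n) (ht : 2 * (2 * c + 1) ≤ n) (κ : ℕ → ℝ)
    (hA : ∀ U ∈ univ.powersetCard (2 * c + 1), ∀ U' ∈ univ.powersetCard (2 * c + 1),
      ∑ M : PMatch n, (if (U.filter fun x => M.2.partner x ∉ U).card = 1 then (1 : ℝ) else 0) *
        (if (U'.filter fun x => M.2.partner x ∉ U').card = 1 then (1 : ℝ) else 0) = κ (U ∩ U').card) :
    0 < kernelEigen n (2 * c + 1) 0 κ := by
  have h := kernelEigen_tight_even_closed hn ht (Nat.zero_le c) κ hA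
  have h0 : kernelEigen n (2 * c + 1) 0 κ = kernelEigen n (2 * c + 1) (2 * 0) κ := rfl
  rw [h0, h]
  obtain ⟨N, hN⟩ := hn
  refine div_pos (mul_pos (pow_pos (mul_pos ?_ ?_) 2) (mul_pos (mul_pos ?_ ?_) ?_)) ?_
  · have : ((2 * c : ℕ) : ℝ) + 1 ≤ n := by exact_mod_cast (show 2 * c + 1 ≤ n by omega)
    push_cast at this ⊢
    linarith
  · exact_mod_cast Nat.choose_pos (by omega)
  · rw [Nat.mul_zero, pmCount_zero]; norm_num
  · rw [Nat.mul_zero, Nat.sub_zero]; exact_mod_cast pmCount_pos ⟨N, hN⟩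
  · simp
  · exact_mod_cast Nat.choose_pos (by omega)

/-- **One-step decay**: `λ_{2κ'+2} ≤ λ_{2κ'}` for `κ' + 1 ≤ c` (eng g7's ratio bound `λ_{2κ'+2} ≤ λ_{2κ'}·(2κ'+1)/(n−2κ')`,
`…TightEvenRatio.kernelEigen_tight_even_succ_le`, with `(2κ'+1)/(n−2κ') ≤ 1` and `λ_{2κ'} ≥ 0`). -/
theorem kernelEigen_tight_succ_le {c κ' : ℕ} (hn : Even n) (ht : 2 * (2 * c + 1) ≤ n) (hκ : κ' + 1 ≤ c) (κ : ℕ → ℝ)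
    (hA : ∀ U ∈ univ.powersetCard (2 * c + 1), ∀ U' ∈ univ.powersetCard (2 * c + 1),
      ∑ M : PMatch n, (if (U.filter fun x => M.2.partner x ∉ U).card = 1 then (1 : ℝ) else 0) *
        (if (U'.filter fun x => M.2.partner x ∉ U').card = 1 then (1 : ℝ) else 0) = κ (U ∩ U').card) :
    kernelEigen n (2 * c + 1) (2 * (κ' + 1)) κ ≤ kernelEigen n (2 * c + 1) (2 * κ') κ := by
  have h := kernelEigen_tight_even_succ_le hn ht hκ κ hA
  have h0 := kernelEigen_tight_even_nonneg hn ht (by omega : κ' ≤ c) κ hA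
  have hc' : ((κ' : ℕ) : ℝ) + 1 ≤ c := by exact_mod_cast hκ
  have hn' : ((4 * c + 2 : ℕ) : ℝ) ≤ n := by exact_mod_cast (show 4 * c + 2 ≤ n by omega)
  push_cast at hn'
  have hpos : (0 : ℝ) < (n : ℝ) - 2 * κ' := by linarith
  have hratio : (2 * κ' + 1 : ℝ) / ((n : ℝ) - 2 * κ') ≤ 1 := by
    rw [div_le_one hpos]; linarith
  calc kernelEigen n (2 * c + 1) (2 * (κ' + 1)) κ
      ≤ kernelEigen n (2 * c + 1) (2 * κ') κ * ((2 * κ' + 1 : ℝ) / ((n : ℝ) - 2 * κ')) := h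
    _ ≤ kernelEigen n (2 * c + 1) (2 * κ') κ * 1 := mul_le_mul_of_nonneg_left hratio h0
    _ = kernelEigen n (2 * c + 1) (2 * κ') κ := mul_one _

/-- **The max-over-κ lemma (referee flag n11).** For `n` even, `t = 2c+1`, `2t ≤ n` and `1 ≤ κ' ≤ c`:
`λ_{2κ'} ≤ λ₂` — the even ladder eigenvalues of the tight Gram kernel are dominated by the second one.
[cite: GodsilMeagher2015, §15.2 (perfect matching scheme)] -/
theorem kernelEigen_tight_even_le_two {c κ' : ℕ} (hn : Even n) (ht : 2 * (2 * c + 1) ≤ n) (h1 : 1 ≤ κ') (hκc : κ' ≤ c)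
    (κ : ℕ → ℝ)
    (hA : ∀ U ∈ univ.powersetCard (2 * c + 1), ∀ U' ∈ univ.powersetCard (2 * c + 1),
      ∑ M : PMatch n, (if (U.filter fun x => M.2.partner x ∉ U).card = 1 then (1 : ℝ) else 0) *
        (if (U'.filter fun x => M.2.partner x ∉ U').card = 1 then (1 : ℝ) else 0) = κ (U ∩ U').card) :
    kernelEigen n (2 * c + 1) (2 * κ') κ ≤ kernelEigen n (2 * c + 1) 2 κ := by
  induction κ', h1 using Nat.le_induction with
  | base => simp
  | succ k hk ih =>
    exact (kernelEigen_tight_succ_le hn ht hκc κ hA).trans (ih (by omega))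

/-- **`λ₂` bounds every non-trivial ladder eigenvalue of the tight Gram kernel** (`1 ≤ j ≤ t`; odd layers vanish by brick 5c). -/
theorem kernelEigen_tight_le_two {c j : ℕ} (hn : Even n) (hc : 1 ≤ c) (ht : 2 * (2 * c + 1) ≤ n) (hj1 : 1 ≤ j)
    (hjt : j ≤ 2 * c + 1) (κ : ℕ → ℝ)
    (hA : ∀ U ∈ univ.powersetCard (2 * c + 1), ∀ U' ∈ univ.powersetCard (2 * c + 1),
      ∑ M : PMatch n, (if (U.filter fun x => M.2.partner x ∉ U).card = 1 then (1 : ℝ) else 0) *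
        (if (U'.filter fun x => M.2.partner x ∉ U').card = 1 then (1 : ℝ) else 0) = κ (U ∩ U').card) :
    kernelEigen n (2 * c + 1) j κ ≤ kernelEigen n (2 * c + 1) 2 κ := by
  rcases Nat.even_or_odd j with ⟨κ', hκ'⟩ | hodd
  · rw [hκ', ← two_mul]
    exact kernelEigen_tight_even_le_two hn ht (by omega) (by omega) κ hA
  · rw [kernelEigen_tight_eq_zero_of_odd ⟨c, rfl⟩ ht hjt hodd κ hA]
    have := kernelEigen_tight_even_nonneg hn ht hc κ hA
    simpa using this

/-! ### §2 The σ₂ brick of record: tight-free rectangles of `t`-cuts × perfect matchings -/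

/-- **Constant row sums of the tight incidence**: the number of perfect matchings tight for a `t`-cut depends only on `t`. -/
theorem tight_rowSum_eq {t : ℕ} (ht : Odd t) {U : Finset (Fin n)} (hU : U.card = t) (U₀ : OddSet n) (hU₀ : U₀.1.card = t) :
    ∑ M : PMatch n, (if (U.filter fun x => M.2.partner x ∉ U).card = 1 then (1 : ℝ) else 0) =
      ((univ.filter fun M : PMatch n => cc U₀ M = 1).card : ℝ) := by
  rw [sum_boole]
  have hoU : Odd U.card := by rw [hU]; exact ht
  have h1 : (univ.filter fun M : PMatch n => (U.filter fun x => M.2.partner x ∉ U).card = 1) =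
      univ.filter fun M : PMatch n => cc ⟨U, hoU⟩ M = 1 :=
    filter_congr fun M _ => by rw [cc_eq_card_filter_partner]
  rw [h1, rowCount_eq 1 ⟨U, hoU⟩ U₀ (by rw [hU₀]; exact hU)]

/-- **The σ₂ brick of record.** Let `n` be even, `t = 2c+1 ≥ 3`, `2t ≤ n`. For every family `X` of `t`-subsets of `[n]` and
every set `Y` of perfect matchings of `K_n` WITHOUT a tight pair (`cc(U,M) ≠ 1` on `X × Y`):
`|X| · |Y| · t(n−t)n ≤ (t−1)(n−t−1) · (C(n,t) − |X|) · (|PM_n| − |Y|)`,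
i.e. `μ(X)ν(Y) ≤ (1−μ)(1−ν)·(t−1)(n−t−1)/(t(n−t)·n) < (1−μ)(1−ν)/n`.
[cite: BrouwerHaemers2012, Thm. 4.9.1 (m' = 0; PDF p. 93)] [cite: GodsilMeagher2015, §15.2] [cite: Rothvoss2017, §2 (PDF p. 6)] -/
theorem tightFree_card_mul_card_le {c : ℕ} (hn : Even n) (hc : 1 ≤ c) (ht : 2 * (2 * c + 1) ≤ n)
    (X : Finset (Finset (Fin n))) (hX : X ⊆ univ.powersetCard (2 * c + 1)) (Y : Finset (PMatch n))
    (hXY : ∀ U ∈ X, ∀ M ∈ Y, (U.filter fun x => M.2.partner x ∉ U).card ≠ 1) :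
    (X.card : ℝ) * Y.card * ((((2 * c + 1 : ℕ) : ℝ)) * ((n : ℝ) - (2 * c + 1 : ℕ)) * n) ≤
      ((((2 * c + 1 : ℕ) : ℝ) - 1) * ((n : ℝ) - (2 * c + 1 : ℕ) - 1)) *
        ((n.choose (2 * c + 1) : ℝ) - X.card) * ((Fintype.card (PMatch n) : ℝ) - Y.card) := by
  have hXle : (X.card : ℝ) ≤ (n.choose (2 * c + 1) : ℝ) := by
    have := card_le_card hX
    rw [card_powersetCard, card_univ, Fintype.card_fin] at this
    exact_mod_cast this
  have hYle : (Y.card : ℝ) ≤ (Fintype.card (PMatch n) : ℝ) := by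
    exact_mod_cast card_le_univ Y
  have hn' : ((4 * c + 2 : ℕ) : ℝ) ≤ n := by exact_mod_cast (show 4 * c + 2 ≤ n by omega)
  have hc' : (1 : ℝ) ≤ c := by exact_mod_cast hc
  push_cast at hn' ⊢
  have hcoef : (0 : ℝ) ≤ (2 * (c : ℝ) + 1 - 1) * ((n : ℝ) - (2 * c + 1) - 1) :=
    mul_nonneg (by linarith) (by linarith)
  -- trivial when the rectangle is empty
  rcases X.eq_empty_or_nonempty with rfl | ⟨U₁, hU₁⟩
  · simp only [card_empty, Nat.cast_zero, zero_mul, sub_zero]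
    exact mul_nonneg (mul_nonneg hcoef (Nat.cast_nonneg _)) (sub_nonneg.2 hYle)
  rcases Y.eq_empty_or_nonempty with rfl | ⟨M₀, hM₀⟩
  · simp only [card_empty, Nat.cast_zero, mul_zero, zero_mul, sub_zero]
    exact mul_nonneg (mul_nonneg hcoef (sub_nonneg.2 hXle)) (Nat.cast_nonneg _)
  -- the tight incidence: Gram class function, constant column and row sums
  obtain ⟨κ, hA⟩ := exists_tightGram_classFunction (n := n) (t := 2 * c + 1) ⟨c, rfl⟩
  have hU₁t : U₁.card = 2 * c + 1 := (mem_powersetCard.1 (hX hU₁)).2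
  have hoU₁ : Odd U₁.card := by rw [hU₁t]; exact ⟨c, rfl⟩
  have hcol := fun M : PMatch n => tight_colSum_eq (n := n) (t := 2 * c + 1) ⟨c, rfl⟩ M M₀
  have hrow : ∀ U ∈ univ.powersetCard (2 * c + 1),
      ∑ M : PMatch n, (if (U.filter fun x => M.2.partner x ∉ U).card = 1 then (1 : ℝ) else 0) =
        ((univ.filter fun M : PMatch n => cc ⟨U₁, hoU₁⟩ M = 1).card : ℝ) :=
    fun U hU => tight_rowSum_eq ⟨c, rfl⟩ (mem_powersetCard.1 hU).2 ⟨U₁, hoU₁⟩ hU₁t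
  have hΛ0 : 0 ≤ kernelEigen n (2 * c + 1) 2 κ := by
    have := kernelEigen_tight_even_nonneg hn ht hc κ hA
    simpa using this
  have hΛ : ∀ j, 1 ≤ j → j ≤ 2 * c + 1 → kernelEigen n (2 * c + 1) j κ ≤ kernelEigen n (2 * c + 1) 2 κ :=
    fun j hj1 hjt => kernelEigen_tight_le_two hn hc ht hj1 hjt κ hA
  have hXY' : ∑ U ∈ X, ∑ M ∈ Y, (if (U.filter fun x => M.2.partner x ∉ U).card = 1 then (1 : ℝ) else 0) = 0 :=
    sum_eq_zero fun U hU => sum_eq_zero fun M hM => if_neg (hXY U hU M hM)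
  -- Haemers, two-sided
  have hH := card_mul_card_mul_rowSum_mul_colSum_le (by omega) _ κ hA hcol hrow hΛ0 hΛ X hX Y hXY'
  -- `λ₀ = d_R d_C`, `λ₂ · t(n−t)n = λ₀ · (t−1)(n−t−1)`, `λ₀ > 0`
  have hl0 := kernelEigen_zero_eq_rowSum_mul_colSum _ κ hA hcol hU₁t (hrow U₁ (hX hU₁))
  have h5g := kernelEigen_two_mul_eq hn hc ht κ hA
  have hpos := kernelEigen_tight_zero_pos hn ht κ hA
  push_cast at h5g
  rw [← hl0] at hH
  -- multiply Haemers by `t(n−t)n`, trade `λ₂·t(n−t)n` for `λ₀·(t−1)(n−t−1)`, cancel `λ₀`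
  have key : kernelEigen n (2 * c + 1) 0 κ *
        ((X.card : ℝ) * Y.card * ((2 * (c : ℝ) + 1) * ((n : ℝ) - (2 * c + 1)) * n)) ≤
      kernelEigen n (2 * c + 1) 0 κ *
        ((2 * (c : ℝ) + 1 - 1) * ((n : ℝ) - (2 * c + 1) - 1) *
          ((n.choose (2 * c + 1) : ℝ) - X.card) * ((Fintype.card (PMatch n) : ℝ) - Y.card)) := by
    have htn : (0 : ℝ) ≤ (2 * (c : ℝ) + 1) * ((n : ℝ) - (2 * c + 1)) * n :=
      mul_nonneg (mul_nonneg (by linarith) (by linarith)) (Nat.cast_nonneg n)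
    calc kernelEigen n (2 * c + 1) 0 κ * ((X.card : ℝ) * Y.card * ((2 * (c : ℝ) + 1) * ((n : ℝ) - (2 * c + 1)) * n))
        = ((X.card : ℝ) * Y.card * kernelEigen n (2 * c + 1) 0 κ) * ((2 * (c : ℝ) + 1) * ((n : ℝ) - (2 * c + 1)) * n) := by
          ring
      _ ≤ (kernelEigen n (2 * c + 1) 2 κ * ((n.choose (2 * c + 1) : ℝ) - X.card) *
            ((Fintype.card (PMatch n) : ℝ) - Y.card)) * ((2 * (c : ℝ) + 1) * ((n : ℝ) - (2 * c + 1)) * n) :=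
          mul_le_mul_of_nonneg_right hH htn
      _ = (kernelEigen n (2 * c + 1) 2 κ * ((2 * (c : ℝ) + 1) * ((n : ℝ) - (2 * c + 1)) * n)) *
            (((n.choose (2 * c + 1) : ℝ) - X.card) * ((Fintype.card (PMatch n) : ℝ) - Y.card)) := by ring
      _ = (kernelEigen n (2 * c + 1) 0 κ * ((2 * (c : ℝ) + 1 - 1) * ((n : ℝ) - (2 * c + 1) - 1))) *
            (((n.choose (2 * c + 1) : ℝ) - X.card) * ((Fintype.card (PMatch n) : ℝ) - Y.card)) := by rw [h5g]
      _ = _ := by ring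
  exact le_of_mul_le_mul_left key hpos

/-- **The σ₂ brick in the route's vocabulary** (`OddSet n`, `cc`): for a family `X` of `t`-cuts (`t = 2c+1 ≥ 3`, `2t ≤ n`, `n` even)
and a set `Y` of perfect matchings with `cc(U,M) ≠ 1` on `X × Y`,
`|X| · |Y| · t(n−t)n ≤ (t−1)(n−t−1) · (C(n,t) − |X|) · (|PM_n| − |Y|)`. [cite: Rothvoss2017, §2 (PDF p. 6)] -/
theorem tightFree_oddSet_card_mul_card_le {c : ℕ} (hn : Even n) (hc : 1 ≤ c) (ht : 2 * (2 * c + 1) ≤ n)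
    (X : Finset (OddSet n)) (hX : ∀ U ∈ X, U.1.card = 2 * c + 1) (Y : Finset (PMatch n))
    (hXY : ∀ U ∈ X, ∀ M ∈ Y, cc U M ≠ 1) :
    (X.card : ℝ) * Y.card * ((((2 * c + 1 : ℕ) : ℝ)) * ((n : ℝ) - (2 * c + 1 : ℕ)) * n) ≤
      ((((2 * c + 1 : ℕ) : ℝ) - 1) * ((n : ℝ) - (2 * c + 1 : ℕ) - 1)) *
        ((n.choose (2 * c + 1) : ℝ) - X.card) * ((Fintype.card (PMatch n) : ℝ) - Y.card) := by
  classical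
  set X' : Finset (Finset (Fin n)) := X.image Subtype.val with hX'
  have hcard : X'.card = X.card := card_image_of_injective _ Subtype.val_injective
  have hX'sub : X' ⊆ univ.powersetCard (2 * c + 1) := by
    intro U hU
    obtain ⟨V, hV, rfl⟩ := mem_image.1 hU
    exact mem_powersetCard.2 ⟨subset_univ _, hX V hV⟩
  have hXY' : ∀ U ∈ X', ∀ M ∈ Y, (U.filter fun x => M.2.partner x ∉ U).card ≠ 1 := by
    intro U hU M hM
    obtain ⟨V, hV, rfl⟩ := mem_image.1 hU
    rw [← cc_eq_card_filter_partner]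
    exact hXY V hV M hM
  have h := tightFree_card_mul_card_le hn hc ht X' hX'sub Y hXY'
  rw [hcard] at h
  exact h

/-- **Coarse form: `μν ≤ 1/n`.** Under the same hypotheses, `|X| · |Y| · n ≤ C(n,t) · |PM_n|`. -/
theorem tightFree_card_mul_card_mul_le {c : ℕ} (hn : Even n) (hc : 1 ≤ c) (ht : 2 * (2 * c + 1) ≤ n)
    (X : Finset (Finset (Fin n))) (hX : X ⊆ univ.powersetCard (2 * c + 1)) (Y : Finset (PMatch n))
    (hXY : ∀ U ∈ X, ∀ M ∈ Y, (U.filter fun x => M.2.partner x ∉ U).card ≠ 1) :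
    (X.card : ℝ) * Y.card * n ≤ (n.choose (2 * c + 1) : ℝ) * Fintype.card (PMatch n) := by
  have h := tightFree_card_mul_card_le hn hc ht X hX Y hXY
  have hXle : (X.card : ℝ) ≤ (n.choose (2 * c + 1) : ℝ) := by
    have := card_le_card hX
    rw [card_powersetCard, card_univ, Fintype.card_fin] at this
    exact_mod_cast this
  have hYle : (Y.card : ℝ) ≤ (Fintype.card (PMatch n) : ℝ) := by exact_mod_cast card_le_univ Y
  have hX0 : (0 : ℝ) ≤ X.card := Nat.cast_nonneg _
  have hY0 : (0 : ℝ) ≤ Y.card := Nat.cast_nonneg _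
  have hn' : ((4 * c + 2 : ℕ) : ℝ) ≤ n := by exact_mod_cast (show 4 * c + 2 ≤ n by omega)
  have hc' : (1 : ℝ) ≤ c := by exact_mod_cast hc
  push_cast at hn' h
  -- `t(n−t) > 0` and `(t−1)(n−t−1)·(C−|X|)(P−|Y|) ≤ t(n−t)·C·P`
  have ht0 : (0 : ℝ) < 2 * (c : ℝ) + 1 := by linarith
  have hnt0 : (0 : ℝ) < (n : ℝ) - (2 * c + 1) := by linarith
  have hA1 : (2 * (c : ℝ) + 1 - 1) * ((n : ℝ) - (2 * c + 1) - 1) ≤ (2 * (c : ℝ) + 1) * ((n : ℝ) - (2 * c + 1)) := by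
    nlinarith
  have hB1 : ((n.choose (2 * c + 1) : ℝ) - X.card) * ((Fintype.card (PMatch n) : ℝ) - Y.card) ≤
      (n.choose (2 * c + 1) : ℝ) * Fintype.card (PMatch n) := by nlinarith
  have hB0 : (0 : ℝ) ≤ ((n.choose (2 * c + 1) : ℝ) - X.card) * ((Fintype.card (PMatch n) : ℝ) - Y.card) :=
    mul_nonneg (sub_nonneg.2 hXle) (sub_nonneg.2 hYle)
  have hcoef0 : (0 : ℝ) ≤ (2 * (c : ℝ) + 1 - 1) * ((n : ℝ) - (2 * c + 1) - 1) :=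
    mul_nonneg (by linarith) (by linarith)
  have h2 : (X.card : ℝ) * Y.card * ((2 * (c : ℝ) + 1) * ((n : ℝ) - (2 * c + 1)) * n) ≤
      ((2 * (c : ℝ) + 1) * ((n : ℝ) - (2 * c + 1))) * ((n.choose (2 * c + 1) : ℝ) * Fintype.card (PMatch n)) := by
    calc (X.card : ℝ) * Y.card * ((2 * (c : ℝ) + 1) * ((n : ℝ) - (2 * c + 1)) * n)
        ≤ (2 * (c : ℝ) + 1 - 1) * ((n : ℝ) - (2 * c + 1) - 1) *
            ((n.choose (2 * c + 1) : ℝ) - X.card) * ((Fintype.card (PMatch n) : ℝ) - Y.card) := h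
      _ = ((2 * (c : ℝ) + 1 - 1) * ((n : ℝ) - (2 * c + 1) - 1)) *
            (((n.choose (2 * c + 1) : ℝ) - X.card) * ((Fintype.card (PMatch n) : ℝ) - Y.card)) := by ring
      _ ≤ ((2 * (c : ℝ) + 1) * ((n : ℝ) - (2 * c + 1))) *
            ((n.choose (2 * c + 1) : ℝ) * Fintype.card (PMatch n)) :=
          mul_le_mul hA1 hB1 hB0 (mul_pos ht0 hnt0).le
  have hf : (0 : ℝ) < (2 * (c : ℝ) + 1) * ((n : ℝ) - (2 * c + 1)) := mul_pos ht0 hnt0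
  have key : ((2 * (c : ℝ) + 1) * ((n : ℝ) - (2 * c + 1))) * ((X.card : ℝ) * Y.card * n) ≤
      ((2 * (c : ℝ) + 1) * ((n : ℝ) - (2 * c + 1))) * ((n.choose (2 * c + 1) : ℝ) * Fintype.card (PMatch n)) := by
    calc ((2 * (c : ℝ) + 1) * ((n : ℝ) - (2 * c + 1))) * ((X.card : ℝ) * Y.card * n)
        = (X.card : ℝ) * Y.card * ((2 * (c : ℝ) + 1) * ((n : ℝ) - (2 * c + 1)) * n) := by ring
      _ ≤ _ := h2
  exact le_of_mul_le_mul_left key hf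

end Summit.PneNP.PneNP.Theorems.ChebyshevTracialDesignTightEigenDecay
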